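import Literature.NumberTheory.Sieve.MatomakiRadziwillLemma4LipschitzCentral
import Literature.NumberTheory.LFunctions.GranvilleSoundararajanCorollary3
import HarnessLib

/-!
# Matomäki–Radziwiłł 2016, Lemma 4: the Lipschitz bounds from `GranvilleSoundararajan2003_theorem4_central` alone

Topic `NumberTheory/Sieve`.  This file reduces the named facts
`MatomakiRadziwill2016_lemma4_lipschitz` (eq. "Lipsch" of Matomäki–Radziwiłł, Ann. of Math. 183 (2016),
§3, proof of Lemma 4) and `MatomakiRadziwill2016_lemma4` (Lemma 4 itself), and the named fact
`GranvilleSoundararajan2003_corollary3` of Granville–Soundararajan 2003, to ONE remaining named fact of the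
tree: `GranvilleSoundararajan2003_theorem4_central` (Theorem 4 of GS03 for `x ≥ x₀`, `1 ≤ w ≤ √x` and
maximisers `y₀` of `|F(1+iy)|` on `|y| ≤ 2 log x` with `|y₀| ≤ log x` — the corrected restatement of the
two defective renderings of Theorem 4, see `GranvilleSoundararajan2003.lean`).

Everything else in the chain is discharged in the tree:
`MatomakiRadziwillL4A.lipschitz_of_GS_of_theorem4_central` (the Matomäki–Radziwiłł deduction with the
corrected Theorem 4), `GranvilleSoundararajan2003_corollary3_of_central4` (Corollary 3 from Theorem 4 for
maximisers `|y₀| ≤ √(log x)`), and `GranvilleSoundararajan2003_theorem1_holds`, `…_lemma23_holds`,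
`…_theorem3_holds`, `…_lemma71_holds`.  The bridge is the inequality `√(log x) ≤ log x` (`x ≥ 3`).

* `MatomakiRadziwillL4A.corollary3_of_theorem4_central : …theorem4_central → …corollary3` (so that
  `GranvilleSoundararajan2003_corollary3_holds` is one line once `…theorem4_central_holds` exists)
* `MatomakiRadziwill2016_lemma4_lipschitz_of_theorem4_central : …theorem4_central → MatomakiRadziwill2016_lemma4_lipschitz`
* `MatomakiRadziwill2016_lemma4_of_theorem4_central : …theorem4_central → MatomakiRadziwill2016_lemma4`

## References
* K. Matomäki, M. Radziwiłł, *Multiplicative functions in short intervals*, Ann. of Math. (2) 183 (2016),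
  §3, Lemma 4 and its proof (arXiv:1501.04585, pp. 9–10). [MatomakiRadziwillAnnals2016]
* A. Granville, K. Soundararajan, *Decay of mean values of multiplicative functions*, Canad. J. Math. 55
  (2003): Theorem 4, §6, Corollary 3, §7. [GranvilleSoundararajan2003]
-/

noncomputable section

open Finset Filter Complex
open Literature.NumberTheory.LFunctions.GranvilleSoundararajan

namespace Literature.NumberTheory.Sieve

/-- Bridge: `GranvilleSoundararajan2003_theorem4_central` (maximisers with `|y₀| ≤ log x`) gives Theorem 4
for maximisers with `|y₀| ≤ √(log x)`, the form hypothesised by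
`GranvilleSoundararajan2003_corollary3_of_central4` (for `x ≥ 3`, `√(log x) ≤ log x`). [folklore] -/
theorem MatomakiRadziwillL4A.theorem4_sqrtLog_of_central (h4 : GranvilleSoundararajan2003_theorem4_central) :
    ∃ C x₀ : ℝ, ∀ f : ArithmeticFunction ℂ, f.IsMultiplicative → (∀ n, ‖f n‖ ≤ 1) →
      ∀ x : ℝ, x₀ ≤ x → ∀ y₀ : ℝ, |y₀| ≤ Real.sqrt (Real.log x) →
        (∀ y : ℝ, |y| ≤ 2 * Real.log x →
          ‖truncEulerProduct f x (1 + y * I)‖ ≤ ‖truncEulerProduct f x (1 + y₀ * I)‖) →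
        ∀ w : ℝ, 1 ≤ w → w ≤ Real.sqrt x →
          ‖(x : ℂ)⁻¹ * ∑ n ∈ Icc 1 ⌊x⌋₊, f n * (n : ℂ) ^ (-(y₀ * I))
              - ((w / x : ℝ) : ℂ) * ∑ n ∈ Icc 1 ⌊x / w⌋₊, f n * (n : ℂ) ^ (-(y₀ * I))‖ ≤
            C * ((Real.log (2 * w) / Real.log x) ^ (1 - 2 / Real.pi)
                    * Real.log (Real.log x / Real.log (2 * w))
                  + Real.log (Real.log x) ^ (1 + 2 * (1 - 2 / Real.pi)) / Real.log x ^ (1 - 2 / Real.pi)) := by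
  obtain ⟨C, x₀, H⟩ := h4
  refine ⟨C, max x₀ 3, fun f hf hfb x hx y₀ hy₀ hmax w hw1 hw2 => ?_⟩
  have hx₀ : x₀ ≤ x := (le_max_left _ _).trans hx
  have hx3 : (3 : ℝ) ≤ x := (le_max_right _ _).trans hx
  have hlog : 1 ≤ Real.log x := by
    rw [← Real.log_exp 1]
    refine Real.log_le_log (Real.exp_pos 1) (le_trans ?_ hx3)
    have := Real.exp_one_lt_d9; linarith
  have h1 : Real.sqrt (Real.log x) ≤ Real.log x := by
    have h2 : Real.sqrt (Real.log x) * Real.sqrt (Real.log x) = Real.log x := Real.mul_self_sqrt (by linarith)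
    have h3 : 1 ≤ Real.sqrt (Real.log x) := Real.one_le_sqrt.mpr hlog
    nlinarith
  exact H f hf hfb x hx₀ y₀ (hy₀.trans h1) hmax w hw1 hw2

/-- **Granville–Soundararajan 2003, Corollary 3 from `GranvilleSoundararajan2003_theorem4_central`.**
[cite: GranvilleSoundararajan2003, Corollary 3 and §7] -/
theorem MatomakiRadziwillL4A.corollary3_of_theorem4_central
    (h4 : GranvilleSoundararajan2003_theorem4_central) : GranvilleSoundararajan2003_corollary3 :=
  GranvilleSoundararajan2003_corollary3_of_central4 (MatomakiRadziwillL4A.theorem4_sqrtLog_of_central h4)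

/-- **Matomäki–Radziwiłł 2016, eq. (Lipsch) from `GranvilleSoundararajan2003_theorem4_central`**: all
other inputs are the tree's discharged facts. [cite: MatomakiRadziwillAnnals2016, §3, proof of Lemma 4] -/
theorem MatomakiRadziwill2016_lemma4_lipschitz_of_theorem4_central
    (h4 : GranvilleSoundararajan2003_theorem4_central) : MatomakiRadziwill2016_lemma4_lipschitz :=
  MatomakiRadziwillL4A.lipschitz_of_GS_of_theorem4_central GranvilleSoundararajan2003_theorem1_holds
    GranvilleSoundararajan2003_lemma23_holds GranvilleSoundararajan2003_theorem3_holds h4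
    (GranvilleSoundararajan2003_corollary3_of_central4 (MatomakiRadziwillL4A.theorem4_sqrtLog_of_central h4))
    GranvilleSoundararajan2003_lemma71_holds

/-- **Matomäki–Radziwiłł 2016, Lemma 4 from `GranvilleSoundararajan2003_theorem4_central`.**
[cite: MatomakiRadziwillAnnals2016, §3, Lemma 4] -/
theorem MatomakiRadziwill2016_lemma4_of_theorem4_central
    (h4 : GranvilleSoundararajan2003_theorem4_central) : MatomakiRadziwill2016_lemma4 :=
  MatomakiRadziwill2016_lemma4_of_lipschitz (MatomakiRadziwill2016_lemma4_lipschitz_of_theorem4_central h4)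

end Literature.NumberTheory.Sieve
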